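import Summits.ABC.ABC.Theorems.TowerFourSubLiouville.Negative.DialCalibration
import Summits.ABC.ABC.Theorems.TowerFourSubLiouville.Negative.LangWaldschmidtSandwich

/-!
# `TowerFourSubLiouville` (stmt-ABC-1649): in the Lang–Waldschmidt₄ hypothesis `hLW` the `ε` is NECESSARY — `LW₄(1)` is false

Negative-side module of the standing disprover (cycle 15, refuter-cdisprove-stmt-ABC-1649-g15-0, 2026-08-17), companion of
`Negative.LangWaldschmidtFloor` (p141178: `LW₄(κ)` false for `κ < 1`, on the dictionary instances `b = (1,4,−1,−4)`) and
`Negative.LangWaldschmidtSandwich` (p143831: `ABC ⟹ LW₄(κ)` for every `κ > 1`, i.e. `ABC ⟹ hLW`).  Those two files left exactly one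
value of the S⁺5 dial undecided: `κ = 1` with a FIXED constant, i.e. the matrix of `hLW` (hypothesis of the landed edge
`stub_cruxOfLangWaldschmidt`, p111401) at `ε = 0`:

  `LW₄(1)`:  `∃ C > 0, ∀ a : Fin 4 → ℕ` positive, `b : Fin 4 → ℤ`, `|bᵢ| ≤ 4`, `Λ := ∑ bᵢ log aᵢ ≠ 0`:  `C · (∏ aᵢ)⁻¹ ≤ |Λ|`,

and recorded it as "open, ⟺ enemies of the core with `|wZ⁴ − vY⁴|·(v³w)^{1/4} = o(Z²)`".  That equivalence only looked at the
dictionary instances.  The typed hypothesis quantifies over ALL coefficient vectors `|bᵢ| ≤ 4`, and on the instance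

  `a = (X, Y, D, 1)`, `b = (3, −2, −1, 0)`, `Λ = log(X³/(DY²))` with `X³ = D·Y² + 1`

it is FALSE: `0 < Λ ≤ 1/(DY²)`, so `Λ · ∏ aᵢ ≤ XYD/(DY²) = X/Y`, and there are solutions of `X³ = DY² + 1` with `Y ≥ N·X` for every
`N` (`hallPell_family`).  Construction (Pell + Matiyasevich, as in `Negative.DialCalibration.not_towerIneq4OneNoEps`): for a solution
`x² − 3y² = 1` put `P := (2x + 3y)·y`, `Q := x² + 3xy + 3y²`; then `Q² = 3P² + 3P + 1` (⟺ `(2Q)² − 3(2P+1)² = 1`, the NEXT-but-one Pell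
solution), so `X := 3P + 1` has `X³ − 1 = (X − 1)(X² + X + 1) = 3P · 3Q² = 9PQ²`.  Taking the Pell index `t = M·y_M`, Matiyasevich's
`y_M² ∣ y_t` (`Pell.ysq_dvd_yy`) gives `y = y_t = e²·y'` with `e = y_M ≥ M`, hence `P = e²P'` and

  `X³ = 9P'·(eQ)² + 1`,  `D := 9P'`,  `Y := eQ ≥ e(P + 1) ≥ (e/3)·X`.

So `|Λ| · ∏ aᵢ ≤ 3/e → 0`: no fixed constant works at exponent `−1` (and a fortiori at any `−κ`, `κ ≤ 1`).  The gain over the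
random-model line is the free square `e² = y_M²` inside `y_{M y_M}`, paid for only logarithmically (`e ≍ log ∏aᵢ / log log ∏aᵢ`), exactly as
in the crux-dial statement `not_towerIneq4OneNoEps` / `Negative.LogLossSharp` — consistent with `ABC ⟹ LW₄(1+ε)` (p143831).

Results (matrix of `hLW` verbatim, exponent `−κ` / `−(1+ε)`):
* `not_langWaldschmidt4_of_le_one`: **`LW₄(κ)` is FALSE for every `κ ≤ 1`** — in particular `not_langWaldschmidt4_one` (`κ = 1`:
  the conjectured exponent with a fixed constant) and `not_hLW_matrix_of_nonpos` (in `hLW` the quantifier `0 < ε` cannot be relaxed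
  to `0 ≤ ε`: the `ε` of Lang–Waldschmidt is necessary already for `m = 4`, `|bᵢ| ≤ 4` — indeed for three logarithms, `b = (3,−2,−1)`).
* `langWaldschmidt4_iff_of_abc'`: **under `ABC`, `LW₄(κ) ⟺ 1 < κ` for EVERY real `κ`** (p143831 had to exclude `κ = 1`).  The S⁺5 row
  of the dial table is now DECIDED at its pin: FALSE `κ ≤ 1` (unconditional) | TRUE `κ > 1` (`ABC`); the edge p111401 consumes `κ = 6/5`.
For the record: the DICTIONARY-restricted `LW₄(1)` (only `b = (1,4,−1,−4)`, i.e. binomial-quartic enemies sub-polynomially below the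
torus Mason–Stothers line) is untouched by this family and stays open; it is not a typed statement of the tree.
In print the conjecture carries the `ε` (S. Lang, *Elliptic Curves: Diophantine Analysis* (1978) pp. 212–213 and M. Waldschmidt,
*Diophantine Approximation on Linear Algebraic Groups* (2000) Conj. 1.11, as cited by the edge file: `|Λ| ≥ C(ε)ᵐ (B^{m−1} ∏ aᵢ)^{−1−ε}`;
in the coefficient aspect Lang, *Number Theory III* Ch. IX Conj. 7.1 — held copy `book:editornd-survey-diophantine-geometry`, PDF
p. 192–193: "Dirichlet's box principle shows that the conjecture gives the best possible exponent"); that the `ε` of the HEIGHT aspect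
cannot be dropped either, by a Pell–Matiyasevich family, is folklore-grade and is recorded here because the tree's `hLW` is typed with
exactly this `ε` — the same slot (`D` in `X³ − DY² = 1`) through which Lang–Waldschmidt yields Hall's conjecture `|x³ − y²| ≫ x^{1/2−ε}`.
-/

-- `Summit.ABC.ABC` is the mandated summit-side namespace (CONVENTIONS §2); the duplicate is deliberate.
set_option linter.dupNamespace false

namespace Summit.ABC.ABC.Theorems.TowerFourSubLiouville.Negative

open scoped BigOperators

/-! ## The family `X³ = D·Y² + 1` with `Y ≥ N·X` -/

/-- The algebra of the construction: from a solution of `x² = 3y² + 1`, `P = (2x+3y)y` and `Q = x² + 3xy + 3y²` satisfy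
`Q² = 3P² + 3P + 1` (so `(3P+1)³ − 1 = 9·P·Q²`). -/
theorem hallPell_algebra {x y : ℕ} (h : x ^ 2 = 3 * y ^ 2 + 1) :
    (x ^ 2 + 3 * x * y + 3 * y ^ 2) ^ 2 = 3 * ((2 * x + 3 * y) * y) ^ 2 + 3 * ((2 * x + 3 * y) * y) + 1 := by
  have hz : (x : ℤ) ^ 2 = 3 * (y : ℤ) ^ 2 + 1 := by exact_mod_cast h
  have : ((x : ℤ) ^ 2 + 3 * x * y + 3 * (y : ℤ) ^ 2) ^ 2
      = 3 * ((2 * (x : ℤ) + 3 * y) * y) ^ 2 + 3 * ((2 * (x : ℤ) + 3 * y) * y) + 1 := by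
    linear_combination ((x : ℤ) ^ 2 + 6 * x * y + 6 * (y : ℤ) ^ 2 + 1) * hz
  exact_mod_cast this

/-- **The Hall–Pell family.**  For every `N` there are positive `X, Y, D` with `X³ = D·Y² + 1` and `N·X ≤ Y`: the cube `X³` sits at
distance `1` above a number with square part `≥ N²X²`.  (Pell `x² − 3y² = 1` at index `t = M·y_M`, `M = 3N+1`, where Matiyasevich's
`y_M² ∣ y_t` supplies a free square `e² = y_M²`, `e ≥ M`; `X = 3P+1`, `Y = eQ`, `D = 9P/e²` in the notation of `hallPell_algebra`.) -/
theorem hallPell_family (N : ℕ) :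
    ∃ X Y D : ℕ, 0 < X ∧ 0 < Y ∧ 0 < D ∧ X ^ 3 = D * Y ^ 2 + 1 ∧ N * X ≤ Y := by
  obtain ⟨e, he⟩ : ∃ e, Pell.yn one_lt_two' (3 * N + 1) = e := ⟨_, rfl⟩
  have heM : 3 * N + 1 ≤ e := he ▸ Pell.yn_ge_n one_lt_two' (3 * N + 1)
  have he0 : 0 < e := lt_of_lt_of_le (Nat.succ_pos _) heM
  obtain ⟨x, hx⟩ : ∃ x, Pell.xn one_lt_two' ((3 * N + 1) * e) = x := ⟨_, rfl⟩
  obtain ⟨y, hy⟩ : ∃ y, Pell.yn one_lt_two' ((3 * N + 1) * e) = y := ⟨_, rfl⟩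
  have hpell : x ^ 2 = 3 * y ^ 2 + 1 := by rw [← hx, ← hy]; exact pell3 _
  have hx0 : 0 < x := hx ▸ Pell.x_pos one_lt_two' _
  have ht0 : 0 < (3 * N + 1) * e := Nat.mul_pos (Nat.succ_pos _) he0
  have hy0 : 0 < y := hy ▸ lt_of_lt_of_le ht0 (Pell.yn_ge_n one_lt_two' _)
  have hdvd : e * e ∣ y := by
    have := Pell.ysq_dvd_yy one_lt_two' (3 * N + 1)
    rwa [he, hy] at this
  obtain ⟨y', hy'⟩ := hdvd
  have hy'0 : 0 < y' := by
    rcases Nat.eq_zero_or_pos y' with h0 | h0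
    · rw [h0, mul_zero] at hy'; omega
    · exact h0
  -- the pieces
  have hQ := hallPell_algebra hpell
  set P : ℕ := (2 * x + 3 * y) * y with hP
  set Q : ℕ := x ^ 2 + 3 * x * y + 3 * y ^ 2 with hQdef
  set P' : ℕ := (2 * x + 3 * y) * y' with hP'
  have hPP' : P = e * e * P' := by rw [hP, hP', hy']; ring
  have hP'0 : 0 < P' := Nat.mul_pos (by omega) hy'0
  have hQ0 : 0 < Q := by rw [hQdef]; positivity
  have hQP : P + 1 ≤ Q := by
    have : (P + 1) ^ 2 ≤ Q ^ 2 := by rw [hQ]; nlinarith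
    exact (Nat.pow_le_pow_iff_left two_ne_zero).mp this
  refine ⟨3 * P + 1, e * Q, 9 * P', Nat.succ_pos _, Nat.mul_pos he0 hQ0, by omega, ?_, ?_⟩
  · calc (3 * P + 1) ^ 3 = 9 * P * (3 * P ^ 2 + 3 * P + 1) + 1 := by ring
      _ = 9 * P * Q ^ 2 + 1 := by rw [hQ]
      _ = 9 * P' * (e * Q) ^ 2 + 1 := by rw [hPP']; ring
  · calc N * (3 * P + 1) ≤ (3 * N + 1) * (P + 1) := by nlinarith [Nat.zero_le (N * P), Nat.zero_le P, Nat.zero_le N]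
      _ ≤ e * Q := Nat.mul_le_mul heM hQP

/-- The smallest non-trivial member, for the record (`N`-free: `M = 1`, `t = 1`, `x = 2`, `y = 1`, `P = 7`, `Q = 13`, `e = 1`):
`22³ = 63·13² + 1 = 10648`; with the free square `e = y_2 = 4` inside `y_8 = 10864 = 16·679` one gets `X = 3P+1` with
`P = (2·18817 + 3·10864)·10864`, `Y = 4Q`, `D = 9P/16`. -/
example : (22 : ℕ) ^ 3 = 63 * 13 ^ 2 + 1 ∧ Pell.yn one_lt_two' 2 = 4 := by
  refine ⟨by norm_num, ?_⟩
  simp [Pell.yn_succ, Pell.xn_succ]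

/-! ## Evaluation of the instance `a = (X, Y, D, 1)`, `b = (3, −2, −1, 0)` -/

/-- `∑ bᵢ log aᵢ = 3 log X − 2 log Y − log D` for `a = (X, Y, D, 1)`, `b = (3, −2, −1, 0)`. -/
theorem lw3_sum_eval (X Y D : ℕ) :
    (∑ i : Fin 4, (((![3, -2, -1, 0] : Fin 4 → ℤ) i : ℤ) : ℝ) * Real.log (((![X, Y, D, 1] : Fin 4 → ℕ) i : ℕ) : ℝ))
      = 3 * Real.log X - 2 * Real.log Y - Real.log D := by
  simp only [Fin.sum_univ_four, Matrix.cons_val_zero, Matrix.cons_val_one, Matrix.cons_val_two,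
    Matrix.cons_val_three, Matrix.head_cons, Matrix.tail_cons]
  push_cast
  simp only [Real.log_one, mul_zero, add_zero]
  ring

/-- `∏ aᵢ = X·Y·D` for `a = (X, Y, D, 1)`. -/
theorem lw3_prod_eval (X Y D : ℕ) :
    (((∏ i : Fin 4, (![X, Y, D, 1] : Fin 4 → ℕ) i : ℕ) : ℝ)) = (X : ℝ) * Y * D := by
  simp only [Fin.prod_univ_four, Matrix.cons_val_zero, Matrix.cons_val_one, Matrix.cons_val_two,
    Matrix.cons_val_three, Matrix.head_cons, Matrix.tail_cons]
  push_cast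
  ring

/-- Entries of `(X, Y, D, 1)` are positive when `X, Y, D` are. -/
theorem lw3_entries_pos {X Y D : ℕ} (hX : 0 < X) (hY : 0 < Y) (hD : 0 < D) :
    ∀ i : Fin 4, 0 < (![X, Y, D, 1] : Fin 4 → ℕ) i := by
  intro i
  fin_cases i
  · simpa using hX
  · simpa using hY
  · simpa using hD
  · simp

/-- The coefficients `(3, −2, −1, 0)` are bounded by `4` in absolute value. -/
theorem lw3_coeffs_le : ∀ i : Fin 4, |(![3, -2, -1, 0] : Fin 4 → ℤ) i| ≤ 4 := by
  intro i
  fin_cases i <;> simp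

/-! ## The dial at and below `1` -/

/-- **`LW₄(κ)` is false for every `κ ≤ 1`; in particular the Lang–Waldschmidt₄ exponent `1` with a FIXED constant fails.**
There is NO `C > 0` with `C (a₁a₂a₃a₄)^{−κ} ≤ |∑ bᵢ log aᵢ|` for all positive `a : Fin 4 → ℕ`, `|bᵢ| ≤ 4`, non-zero forms —
already for `a = (X, Y, D, 1)`, `b = (3, −2, −1, 0)` along `hallPell_family`: `Λ = log(1 + 1/(DY²)) ∈ (0, 1/(DY²)]`,
`∏ aᵢ = XYD`, so `Λ · (∏ aᵢ)^κ ≤ Λ · ∏ aᵢ ≤ X/Y ≤ 1/N`.  (Matrix of `hLW` in `stub_cruxOfLangWaldschmidt` verbatim, `−κ` for `−(1+ε)`.) -/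
theorem not_langWaldschmidt4_of_le_one {κ : ℝ} (hκ : κ ≤ 1) :
    ¬ ∃ C : ℝ, 0 < C ∧ ∀ a : Fin 4 → ℕ, ∀ b : Fin 4 → ℤ, (∀ i, 0 < a i) → (∀ i, |b i| ≤ 4) →
      (∑ i, (b i : ℝ) * Real.log (a i : ℝ)) ≠ 0 →
      C * (((∏ i, a i : ℕ) : ℝ)) ^ (-κ) ≤ |∑ i, (b i : ℝ) * Real.log (a i : ℝ)| := by
  rintro ⟨C, hC, hLW⟩
  -- a member of the family with `X/Y ≤ 1/N < C`
  obtain ⟨N, hN⟩ := exists_nat_gt (1 / C)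
  have hN0 : (0 : ℝ) < N := lt_trans (by positivity) hN
  obtain ⟨X, Y, D, hX, hY, hD, hid, hNXY⟩ := hallPell_family N
  have hXr : (0 : ℝ) < X := by exact_mod_cast hX
  have hYr : (0 : ℝ) < Y := by exact_mod_cast hY
  have hDr : (0 : ℝ) < D := by exact_mod_cast hD
  set A : ℝ := (X : ℝ) ^ 3 with hA
  set B : ℝ := (D : ℝ) * (Y : ℝ) ^ 2 with hB
  have hB0 : 0 < B := by positivity
  have hAB : A = B + 1 := by
    have : ((X ^ 3 : ℕ) : ℝ) = ((D * Y ^ 2 + 1 : ℕ) : ℝ) := by exact_mod_cast hid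
    push_cast at this
    rw [hA, hB]; exact this
  have hA0 : 0 < A := by rw [hAB]; positivity
  -- the linear form `Λ = log A − log B = log (1 + 1/B) ∈ (0, 1/B]`
  have hΛeval : 3 * Real.log X - 2 * Real.log Y - Real.log D = Real.log (A / B) := by
    rw [Real.log_div hA0.ne' hB0.ne', hA, hB, Real.log_pow, Real.log_mul hDr.ne' (pow_pos hYr 2).ne', Real.log_pow]
    push_cast; ring
  have hquot : A / B = 1 + 1 / B := by rw [hAB]; field_simp
  have hquot1 : 1 < A / B := by rw [hquot]; simp [hB0]
  have hΛpos : 0 < Real.log (A / B) := Real.log_pos hquot1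
  have hΛle : Real.log (A / B) ≤ 1 / B := by
    have := Real.log_le_sub_one_of_pos (div_pos hA0 hB0)
    rw [hquot] at this ⊢; linarith
  -- the instance of the hypothesis
  have hinst := hLW (![X, Y, D, 1]) (![3, -2, -1, 0]) (lw3_entries_pos hX hY hD) lw3_coeffs_le
    (by rw [lw3_sum_eval, hΛeval]; exact hΛpos.ne')
  rw [lw3_sum_eval, hΛeval, lw3_prod_eval, abs_of_pos hΛpos] at hinst
  -- `P = XYD ≥ 1`; monotonicity in the dial: `C P⁻¹ ≤ C P^{−κ} ≤ Λ ≤ 1/B`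
  set P : ℝ := (X : ℝ) * Y * D with hP
  have hP0 : 0 < P := by positivity
  have hP1 : 1 ≤ P := by
    have h : (1 : ℕ) ≤ X * Y * D := Nat.one_le_iff_ne_zero.mpr (by positivity)
    have : ((1 : ℕ) : ℝ) ≤ ((X * Y * D : ℕ) : ℝ) := by exact_mod_cast h
    push_cast at this
    rw [hP]; exact this
  have hmono : P ^ (-(1 : ℝ)) ≤ P ^ (-κ) := Real.rpow_le_rpow_of_exponent_le hP1 (by linarith)
  have hchain : C * P⁻¹ ≤ 1 / B := by
    have := le_trans (mul_le_mul_of_nonneg_left hmono hC.le) (hinst.trans hΛle)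
    rwa [Real.rpow_neg_one] at this
  -- i.e. `C ≤ P/B = X/Y ≤ 1/N < C`
  have hCle : C ≤ P / B := by
    have := mul_le_mul_of_nonneg_right hchain hP0.le
    calc C = C * P⁻¹ * P := by rw [mul_assoc, inv_mul_cancel₀ hP0.ne', mul_one]
      _ ≤ 1 / B * P := this
      _ = P / B := by ring
  have hPB : P / B = (X : ℝ) / Y := by
    rw [hP, hB]; field_simp
  have hXY : (X : ℝ) / Y ≤ 1 / N := by
    rw [div_le_div_iff₀ hYr hN0]
    have : ((N * X : ℕ) : ℝ) ≤ ((Y : ℕ) : ℝ) := by exact_mod_cast hNXY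
    push_cast at this; linarith
  have h1 : 1 < (N : ℝ) * C := by rwa [div_lt_iff₀ hC] at hN
  have h1N : 1 / (N : ℝ) < C := by rw [div_lt_iff₀ hN0]; linarith [mul_comm (N : ℝ) C]
  linarith [hCle, hPB, hXY, h1N]

/-- **The Lang–Waldschmidt₄ exponent `1` with a fixed constant is false** (`κ = 1`; the value left open by p141178/p143831). -/
theorem not_langWaldschmidt4_one :
    ¬ ∃ C : ℝ, 0 < C ∧ ∀ a : Fin 4 → ℕ, ∀ b : Fin 4 → ℤ, (∀ i, 0 < a i) → (∀ i, |b i| ≤ 4) →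
      (∑ i, (b i : ℝ) * Real.log (a i : ℝ)) ≠ 0 →
      C * (((∏ i, a i : ℕ) : ℝ)) ^ (-(1 : ℝ)) ≤ |∑ i, (b i : ℝ) * Real.log (a i : ℝ)| :=
  not_langWaldschmidt4_of_le_one le_rfl

/-- **In `hLW` the `ε` is necessary**: the matrix of `stub_cruxOfLangWaldschmidt`'s hypothesis at any fixed `ε ≤ 0` is false —
the quantifier `0 < ε` cannot be relaxed to `0 ≤ ε` (p141178 had `ε < 0`). -/
theorem not_hLW_matrix_of_nonpos {ε : ℝ} (hε : ε ≤ 0) :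
    ¬ ∃ C : ℝ, 0 < C ∧ ∀ a : Fin 4 → ℕ, ∀ b : Fin 4 → ℤ, (∀ i, 0 < a i) → (∀ i, |b i| ≤ 4) →
      (∑ i, (b i : ℝ) * Real.log (a i : ℝ)) ≠ 0 →
      C * (((∏ i, a i : ℕ) : ℝ)) ^ (-(1 + ε)) ≤ |∑ i, (b i : ℝ) * Real.log (a i : ℝ)| :=
  not_langWaldschmidt4_of_le_one (by linarith)

/-- **The S⁺5 dial DECIDED at its pin: under `ABC`, `LW₄(κ) ⟺ 1 < κ` for EVERY real `κ`** (p143831's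
`langWaldschmidt4_iff_of_abc` needed `κ ≠ 1`; the new floor removes the exception).  Unconditionally: `LW₄(κ) ⟹ 1 < κ`. -/
theorem langWaldschmidt4_iff_of_abc' (habc : ABC) (κ : ℝ) :
    (∃ C : ℝ, 0 < C ∧ ∀ a : Fin 4 → ℕ, ∀ b : Fin 4 → ℤ, (∀ i, 0 < a i) → (∀ i, |b i| ≤ 4) →
      (∑ i, (b i : ℝ) * Real.log (a i : ℝ)) ≠ 0 →
      C * (((∏ i, a i : ℕ) : ℝ)) ^ (-κ) ≤ |∑ i, (b i : ℝ) * Real.log (a i : ℝ)|) ↔ 1 < κ := by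
  constructor
  · intro h
    by_contra hle
    push Not at hle
    exact not_langWaldschmidt4_of_le_one hle h
  · exact langWaldschmidt4_of_abc habc

/-- The unconditional half, stated alone: an admissible Lang–Waldschmidt₄ exponent is `> 1`. -/
theorem one_lt_of_langWaldschmidt4 {κ : ℝ}
    (h : ∃ C : ℝ, 0 < C ∧ ∀ a : Fin 4 → ℕ, ∀ b : Fin 4 → ℤ, (∀ i, 0 < a i) → (∀ i, |b i| ≤ 4) →
      (∑ i, (b i : ℝ) * Real.log (a i : ℝ)) ≠ 0 →
      C * (((∏ i, a i : ℕ) : ℝ)) ^ (-κ) ≤ |∑ i, (b i : ℝ) * Real.log (a i : ℝ)|) : 1 < κ := by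
  by_contra hle
  push Not at hle
  exact not_langWaldschmidt4_of_le_one hle h

end Summit.ABC.ABC.Theorems.TowerFourSubLiouville.Negative
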